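import Literature.MathematicalPhysics.QuantumFieldTheory.Balaban1983to89.B16Ineq382VPrime

/-!
# `Balaban1983to89.B16Ineq382AxialSlice` — T. Bałaban, *Large field renormalization. II. Localization, exponentiation, and bounds for the 𝐑 operation*, Commun. Math. Phys. **122** (1989) 355–392 [Balaban1989LargeFieldII], p. 381: *"We obtain the field V₁ = V″^v = v₋V′V₀v₊⁻¹, which satisfies … the axial gauge conditions"* — PROVED in the BONDWISE form in which [Balaban1989LargeFieldI] p. 196 states the gauge (*"We fix the gauge putting the bond variables equal to 1 for bonds belonging to the tree graph"*), via the holonomy-prefix property of the contour system `Γ_{y,x}` of [IV] p. 196 (PART 4 of the case-1 estimate of pp. 381–382; PARTS 1–3 = `B16Ineq382Stokes`, `B16Ineq382Cases`/`B16Ineq382TreeGauge`, `B16Ineq382VPrime`)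

statement-level skeleton of published theorems with citation tags; proofs where landed; nothing here is a claim about the Yang–Mills mass gap

PDF held: `paper:balaban1989-cmp122-large-field-ii` (journal page = PDF page + 354; p. 381 = PDF p. 27, render
`run/shared/lean/pub/pub-balaban/b2b-balaban-ref1/pages/1989-cmp122-large-field-II/…-p027-x2.png`);
`paper:balaban1989-cmp122-large-field-i` = [IV] (p. 196 = PDF p. 22, render `…1989-cmp122-large-field-I-p022-x2.png`).

WHAT IS REPRODUCED (mega-formalization `lit-balaban`, HOME `run/shared/lean/pub/lit-balaban/`, Phase-2 seat p26,
generation 3; SKELETON row **B16.Lem@381** (r13), with row B15.Def@196 (r12; transport reading = this seat's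
`B15TreeGauge196*`)).  [IV] p. 196 (render re-read): *"If x₁ ≦ a, then we take the usual contour Γ_{y,x} = [y,(y₁,…,
y_{d−1},x_d)] ∪ ⋯ ∪ [(y₁,x₂,…,x_d), x]. If x₁ > a, then we take the contour Γ_{y,x} = [y,(y₁,…,y_{d−1},x_d)] ∪ ⋯ ∪ [(y₁,
y₂,x₃,…,x_d),(b₁ − 1/2,y₂,x₃,…,x_d)] ∪ [(b₁ − 1/2,y₂,x₃,…,x_d),(b₁ − 1/2,x₂,x₃,…,x_d)] ∪ [(b₁ − 1/2,x₂,x₃,…,x_d), x].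
… The union of all the contours is a tree graph T on P₁∖P₂ … We fix the gauge putting the bond variables equal to 1
for bonds belonging to the tree graph."*  [Balaban1989LargeFieldII] p. 381: *"transform the field V″ into a field
satisfying the axial gauge conditions. The gauge transformation v … is given by v(x) = V₀(Γ_{y,x}) … We obtain the
field V₁ = V″^v = v₋V′V₀v₊⁻¹, which satisfies … the axial gauge conditions."*  PART 2 (`B15TreeGauge196.
hol_treeGauge_contour`) proved the CONTOUR form `V^v(Γ_{y,x}) = 1` of these conditions for `v(x) = V(Γ_{y,x})`; this
part proves the printed BONDWISE form — every bond variable of `V^v` met along every contour `Γ_{y,x}`, `x ∈ P₁`,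
equals `1` (`bondsOneAlong_gaugeFixed`, in PART 3's vocabulary `BondsOneAlong`), i.e. every gauge orbit meets the
tree-gauge slice on `T = ⋃ Γ_{y,x}` (what the Faddeev–Popov `δ_{T₀}(V′)` of [IV] p. 196 presupposes on `P₁∖P₂`) — and,
in the situation `FluctHyp` of PART 3 (`V′` on the slice, `v(x) = V₀(Γ_{y,x})`), that the printed `V₁ = (V′V₀)^v`
satisfies them too (`FluctHyp.bondsOneAlong_V₁`).  THE COMBINATORIAL HEART (§10–§11): **`hol_contour_prefix`** — for
`x ∈ P₁` and every prefix `u` of the word `Γ_{y,x}`, ending at the lattice point `z`, the parallel transport along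
`Γ_{y,z}` equals that along `u`: `V(Γ_{y,z}) = V(u)`.  For the usual contours and for all but one piece of the
detour this is an equality of WORDS (`tw_prefix`: a prefix of a tree word is the tree word of its own end point);
on the first leg of the detour beyond the threshold (`a < z₁ < b₁ − 1/2`, `z₂ = y₂`) the printed `Γ_{y,z}` runs to
the far face `x₁ = b₁ − 1/2` and straight back to `z`, and the identity holds because the backtracking cancels
(`hol_seg_backtrack`).

HONEST SCOPE.  As PARTS 1–3: the contour family of ONE annulus `P₁∖P₂ ⊂ ℤ^{n+3}` typed as words from the corner `y`
(`B15TreeGauge196.contour`), hypotheses `y₁ ≦ a < b₁ − 1/2` (`lo i0 ≤ τ < hi i0`) and `x ∈ P₁`; arbitrary group-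
valued bond fields (no norm needed here).  Not typed: the external bonds of `T₀`, `δ_{T₀}`.  Every declaration is a
proved theorem; nothing of [IV]/[V] is asserted.  Unit `lit-balaban-p26` (literature-prover-lit-balaban-p26-g3-0).
-/

noncomputable section

open scoped BigOperators

namespace Literature.MathematicalPhysics.QuantumFieldTheory.Balaban1983to89.B16Ineq382

open B7Prop1Explicit B8Lemma1NonAbelian B15TreeGauge196

variable {d : ℕ}

/-! ## §10 Prefixes of tree words ([IV] p. 196: the usual contours) -/

section Prefix

/-- A tree word over coordinates that all vanish is empty. [cite: Balaban1989LargeFieldI, p.196] -/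
theorem tw_eq_nil {K : List (Fin d)} {v : Site d} (h : ∀ κ ∈ K, v κ = 0) : tw K v = [] := by
  induction K with
  | nil => rfl
  | cons κ K ih =>
    rw [tw_cons, h κ (by simp), seg_zero, List.nil_append]
    exact ih fun κ' hκ' => h κ' (List.mem_cons_of_mem κ hκ')

/-- The `κ`-coordinate of the displacement of a word without `κ`-letters is `0`. [cite: Balaban1989LargeFieldI, p.196] -/
theorem disp_apply_eq_zero {w : List (Letter d)} {κ : Fin d} (h : ∀ l ∈ w, l.1 ≠ κ) : disp w κ = 0 := by
  induction w with
  | nil => simp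
  | cons l w ih =>
    obtain ⟨μ, b⟩ := l
    have hne : κ ≠ μ := fun h' => h (μ, b) (by simp) h'.symm
    have ih' := ih fun l' hl' => h l' (List.mem_cons_of_mem _ hl')
    rw [disp_cons, Pi.add_apply, ih', add_zero]
    cases b
    · rw [Letter.vec_false, Pi.neg_apply, e_apply, if_neg hne, neg_zero]
    · rw [Letter.vec_true, e_apply, if_neg hne]

/-- A prefix of a forward straight segment is a shorter forward segment. [cite: Balaban1989LargeFieldI, p.196] -/
theorem seg_eq_append {κ : Fin d} {m : ℕ} {u u' : List (Letter d)} (h : seg κ (m : ℤ) = u ++ u') :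
    ∃ j : ℕ, j ≤ m ∧ u = seg κ (j : ℤ) := by
  rw [seg_natCast] at h
  obtain ⟨hlen, hu, -⟩ := List.append_eq_replicate_iff.mp h.symm
  exact ⟨u.length, by omega, by rw [seg_natCast]; exact hu⟩

/-- A prefix of a backward straight segment is a shorter backward segment. [cite: Balaban1989LargeFieldI, p.196] -/
theorem seg_neg_eq_append {κ : Fin d} {m : ℕ} {u u' : List (Letter d)} (h : seg κ (-(m : ℤ)) = u ++ u') :
    ∃ j : ℕ, j ≤ m ∧ u = seg κ (-(j : ℤ)) := by
  rw [seg_neg_natCast] at h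
  obtain ⟨hlen, hu, -⟩ := List.append_eq_replicate_iff.mp h.symm
  exact ⟨u.length, by omega, by rw [seg_neg_natCast]; exact hu⟩

/-- **Prefixes of tree words** (the usual contours of [IV] p. 196 and B5 (1.7)): for a list of directions without
repetition and `v` non-negative on it, a prefix `u` of `tw K v` is the tree word of its own displacement, whose
listed coordinates lie between `0` and those of `v` and whose other coordinates vanish — so a prefix of a usual
contour `Γ_{y,x}` ending at `z` IS the usual contour `Γ_{y,z}`. [cite: Balaban1989LargeFieldI, p.196] -/
theorem tw_prefix {K : List (Fin d)} (hK : K.Nodup) {v : Site d} (hv : ∀ κ ∈ K, 0 ≤ v κ) {u u' : List (Letter d)}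
    (h : tw K v = u ++ u') :
    tw K (disp u) = u ∧ (∀ κ ∈ K, 0 ≤ disp u κ ∧ disp u κ ≤ v κ) ∧ (∀ κ ∉ K, disp u κ = 0) := by
  induction K generalizing u u' with
  | nil =>
    rw [tw_nil] at h
    have hu : u = [] := (List.nil_eq_append_iff.mp h).1
    subst hu
    simp
  | cons κ K ih =>
    have hκ : κ ∉ K := (List.nodup_cons.mp hK).1
    have hK' : K.Nodup := (List.nodup_cons.mp hK).2
    have hv' : ∀ κ' ∈ K, 0 ≤ v κ' := fun κ' h' => hv κ' (List.mem_cons_of_mem κ h')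
    obtain ⟨m, hm⟩ := Int.eq_ofNat_of_zero_le (hv κ (by simp))
    rw [tw_cons, hm] at h
    rcases List.append_eq_append_iff.mp h with ⟨a', hu, ha'⟩ | ⟨c', hc', -⟩
    · -- `u = seg κ m ++ a'` with `a'` a prefix of `tw K v`
      obtain ⟨h1, h2, h3⟩ := ih (u := a') (u' := u') hK' hv' ha'
      subst hu
      have hdisp : ∀ κ', disp (seg κ (m : ℤ) ++ a') κ' = (if κ' = κ then (m : ℤ) else 0) + disp a' κ' :=
        fun κ' => by rw [disp_append, disp_seg, Pi.add_apply, zsmul_e_apply]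
      have hK_eq : tw K (disp (seg κ (m : ℤ) ++ a')) = tw K (disp a') := tw_congr fun κ' hκ' => by
        rw [hdisp, if_neg (fun h' : κ' = κ => hκ (h' ▸ hκ')), zero_add]
      refine ⟨?_, ?_, ?_⟩
      · rw [tw_cons, hK_eq, h1, hdisp, if_pos rfl, h3 κ hκ, add_zero]
      · intro κ' hκ'
        rcases List.mem_cons.mp hκ' with h' | hκ'K
        · subst h'
          rw [hdisp, if_pos rfl, h3 _ hκ, add_zero, hm]
          exact ⟨by positivity, le_rfl⟩
        · rw [hdisp, if_neg (fun h' : κ' = κ => hκ (h' ▸ hκ'K)), zero_add]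
          exact h2 κ' hκ'K
      · intro κ' hκ'
        have hne : κ' ≠ κ := by
          rintro rfl
          exact hκ' (List.mem_cons.mpr (Or.inl rfl))
        have hnK : κ' ∉ K := fun h' => hκ' (List.mem_cons_of_mem κ h')
        rw [hdisp, if_neg hne, zero_add, h3 κ' hnK]
    · -- `u` is a prefix of the first segment
      obtain ⟨j, hjm, rfl⟩ := seg_eq_append hc'
      have hdisp : ∀ κ', disp (seg κ (j : ℤ)) κ' = if κ' = κ then (j : ℤ) else 0 := fun κ' => by
        rw [disp_seg, zsmul_e_apply]
      refine ⟨?_, ?_, ?_⟩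
      · rw [tw_cons, hdisp, if_pos rfl, tw_eq_nil fun κ' hκ' => ?_, List.append_nil]
        rw [hdisp, if_neg (fun h' : κ' = κ => hκ (h' ▸ hκ'))]
      · intro κ' hκ'
        rcases List.mem_cons.mp hκ' with h' | hκ'K
        · subst h'
          rw [hdisp, if_pos rfl, hm]
          exact ⟨by positivity, by exact_mod_cast hjm⟩
        · rw [hdisp, if_neg (fun h' : κ' = κ => hκ (h' ▸ hκ'K))]
          exact ⟨le_rfl, hv' κ' hκ'K⟩
      · intro κ' hκ'
        have hne : κ' ≠ κ := by
          rintro rfl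
          exact hκ' (List.mem_cons.mpr (Or.inl rfl))
        rw [hdisp, if_neg hne]

end Prefix

/-! ## §11 Holonomy along prefixes of the contours `Γ_{y,x}` ([IV] p. 196: the detour) -/

section ContourPrefix

variable {n : ℕ} {G : Type*} [Group G]

/-- **Backtracking cancels**: going `j + i` steps in direction `κ` and `i` steps back has the parallel transport of
going `j` steps — the one place where the printed contour `Γ_{y,z}` (to the far face and back, for `z` on the first
leg of the detour with `z₁ > a`) differs as a word from the prefix of `Γ_{y,x}`. [cite: Balaban1989LargeFieldI, p.196] -/
theorem hol_seg_backtrack (V : Site d → Fin d → G) (p : Site d) (κ : Fin d) (j i : ℕ) :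
    hol V p (seg κ ((j + i : ℕ) : ℤ) ++ seg κ (-(i : ℤ))) = hol V p (seg κ (j : ℤ)) := by
  have hs : seg κ ((j + i : ℕ) : ℤ) = seg κ (j : ℤ) ++ seg κ (i : ℤ) := by
    rw [seg_natCast, seg_natCast, seg_natCast, List.replicate_add]
  have hrev : hol V (p + (j : ℤ) • e κ + (i : ℤ) • e κ) (seg κ (-(i : ℤ))) =
      (hol V (p + (j : ℤ) • e κ) (seg κ (i : ℤ)))⁻¹ := by
    rw [← revWord_seg]
    exact hol_revWord' V _ _ (by rw [disp_seg])
  rw [hs, List.append_assoc, hol_append, hol_append, disp_seg, disp_seg, hrev, mul_inv_cancel, mul_one]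

variable {lo hi : Site (n + 3)} {τ : ℤ}

/-- The high part of a contour does not see the first two coordinates. [cite: Balaban1989LargeFieldI, p.196] -/
theorem tw_highDirs_pt (a b : ℤ) (x : Site (n + 3)) :
    tw (highDirs n) (pt a b x - lo) = tw (highDirs n) (x - lo) :=
  tw_congr fun κ hκ => by rw [Pi.sub_apply, Pi.sub_apply, pt_high _ _ _ (mem_highDirs.mp hκ)]

/-- The usual contour of a point `(a, b, x₃, …)` with `a ≦ τ`. [cite: Balaban1989LargeFieldI, p.196] -/
theorem contour_pt_usual {a b : ℤ} {x : Site (n + 3)} (ha : a ≤ τ) :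
    contour lo hi τ (pt a b x) = tw (highDirs n) (x - lo) ++ seg i1 (b - lo i1) ++ seg i0 (a - lo i0) := by
  have ha' : (pt a b x) i0 ≤ τ := by simpa using ha
  rw [contour_of_le ha', treeWord_eq, tw_highDirs_pt, Pi.sub_apply, pt_i1, Pi.sub_apply, pt_i0]

/-- The detour contour of a point `(a, b, x₃, …)` with `a > τ`. [cite: Balaban1989LargeFieldI, p.196] -/
theorem contour_pt_detour {a b : ℤ} {x : Site (n + 3)} (ha : ¬ a ≤ τ) :
    contour lo hi τ (pt a b x) =
      tw (highDirs n) (x - lo) ++ (seg i0 (hi i0 - lo i0) ++ seg i1 (b - lo i1) ++ seg i0 (a - hi i0)) := by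
  have ha' : ¬ (pt a b x) i0 ≤ τ := by simpa using ha
  rw [contour_of_not_le ha', tw_highDirs_pt, detourTail, pt_i0, pt_i1]

/-- **Holonomy along prefixes of the contours** ([IV] p. 196, the property that makes `v(x) = V(Γ_{y,x})` fix the
gauge BONDWISE): for `y₁ ≦ a < b₁ − 1/2`, `x ∈ P₁`, and every decomposition `Γ_{y,x} = u ∪ u′` at a lattice point
`z = y + disp u`, the parallel transport along `Γ_{y,z}` equals that along `u`.  (Equality of words except when `z`
lies on the first leg of the detour beyond the threshold, where `Γ_{y,z}` backtracks from the far face.)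
[cite: Balaban1989LargeFieldI, p.196] -/
theorem hol_contour_prefix (V : Site (n + 3) → Fin (n + 3) → G) (hlo : lo i0 ≤ τ) (hτ : τ < hi i0)
    {x : Site (n + 3)} (hx : x ∈ box lo hi) {u u' : List (Letter (n + 3))} (h : contour lo hi τ x = u ++ u') :
    hol V lo (contour lo hi τ (lo + disp u)) = hol V lo u := by
  have hxb := mem_box_iff.mp hx
  have hv : ∀ κ, 0 ≤ (x - lo) κ := fun κ => by simpa using (hxb κ).1
  by_cases hxτ : x i0 ≤ τ
  · -- the usual contour: every prefix is the usual contour of its end point, as a word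
    rw [contour_of_le hxτ, treeWord_eq_tw] at h
    obtain ⟨h1, h2, -⟩ := tw_prefix finRange_reverse_nodup (fun κ _ => hv κ) h
    have hz : (lo + disp u) i0 ≤ τ := by
      have := (h2 i0 (by simp)).2
      simp only [Pi.add_apply, Pi.sub_apply] at this ⊢
      omega
    rw [contour_of_le hz, treeWord_eq_tw, add_sub_cancel_left, h1]
  · -- the detour
    obtain ⟨N, hN⟩ := Int.eq_ofNat_of_zero_le (show 0 ≤ hi i0 - lo i0 by linarith [(hxb i0).1, (hxb i0).2])
    obtain ⟨m, hm⟩ := Int.eq_ofNat_of_zero_le (show 0 ≤ x i1 - lo i1 by linarith [(hxb i1).1])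
    obtain ⟨k, hk⟩ := Int.eq_ofNat_of_zero_le (show 0 ≤ hi i0 - x i0 by linarith [(hxb i0).2])
    have hT : detourTail lo hi x = seg i0 (N : ℤ) ++ seg i1 (m : ℤ) ++ seg i0 (-(k : ℤ)) := by
      rw [detourTail, hN, hm, show x i0 - hi i0 = -(k : ℤ) by omega]
    rw [contour_of_not_le hxτ, hT] at h
    have hp1 : lo + disp (tw (highDirs n) (x - lo)) = pt (lo i0) (lo i1) x := by
      rw [disp_tw highDirs_nodup, add_restrict_highDirs]
    rcases List.append_eq_append_iff.mp h with ⟨a', hu, ha'⟩ | ⟨c', hc', -⟩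
    · -- `u = (high part) ++ a'`, `a'` a prefix of the three detour pieces
      rcases List.append_eq_append_iff.mp ha' with ⟨a'', rfl, hk'⟩ | ⟨c'', hc'', -⟩
      · -- `a'` reaches into the last piece: `z = (b₁ − 1/2 − j, x₂, x₃, …)`, a detour point, exact word
        obtain ⟨j, hjk, rfl⟩ := seg_neg_eq_append hk'
        have hz : lo + disp u = pt (lo i0 + (N : ℤ) + -(j : ℤ)) (lo i1 + (m : ℤ)) x := by
          have : lo + disp u = lo + disp (tw (highDirs n) (x - lo)) + (N : ℤ) • e i0 + (m : ℤ) • e i1 +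
              (-(j : ℤ)) • e i0 := by
            simp only [hu, disp_append, disp_seg, add_assoc]
          rw [this, hp1, pt_add_e0, pt_add_e1, pt_add_e0]
        have hzτ : ¬ lo i0 + (N : ℤ) + -(j : ℤ) ≤ τ := by omega
        rw [hz, contour_pt_detour hzτ, hN, add_sub_cancel_left,
          show lo i0 + (N : ℤ) + -(j : ℤ) - hi i0 = -(j : ℤ) by omega, hu]
      · rcases List.append_eq_append_iff.mp hc'' with ⟨a₃, rfl, hm'⟩ | ⟨c₃, hc₃, -⟩
        · -- `a'` ends on the far face `x₁ = b₁ − 1/2`: a detour point, exact word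
          obtain ⟨j, hjm, rfl⟩ := seg_eq_append hm'
          have hz : lo + disp u = pt (lo i0 + (N : ℤ)) (lo i1 + (j : ℤ)) x := by
            have : lo + disp u = lo + disp (tw (highDirs n) (x - lo)) + (N : ℤ) • e i0 + (j : ℤ) • e i1 := by
              simp only [hu, disp_append, disp_seg, add_assoc]
            rw [this, hp1, pt_add_e0, pt_add_e1]
          have hzτ : ¬ lo i0 + (N : ℤ) ≤ τ := by omega
          rw [hz, contour_pt_detour hzτ, hN, add_sub_cancel_left, show lo i0 + (N : ℤ) - hi i0 = 0 by omega,
            seg_zero, List.append_nil, hu]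
        · -- `a'` ends on the first leg `[(y₁,y₂,x₃,…),(b₁ − 1/2,y₂,x₃,…)]`: `z = (y₁ + j, y₂, x₃, …)`
          obtain ⟨j, hjN, rfl⟩ := seg_eq_append hc₃
          have hz : lo + disp u = pt (lo i0 + (j : ℤ)) (lo i1) x := by
            rw [hu, disp_append, ← add_assoc, hp1, disp_seg, pt_add_e0]
          by_cases hzτ : lo i0 + (j : ℤ) ≤ τ
          · -- `z₁ ≦ a`: `Γ_{y,z}` is usual and is the prefix, as a word
            rw [hz, contour_pt_usual hzτ, sub_self, seg_zero, List.append_nil, add_sub_cancel_left, hu]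
          · -- `z₁ > a`: `Γ_{y,z}` runs to the far face and back — backtracking cancels
            obtain ⟨i, rfl⟩ : ∃ i, N = j + i := ⟨N - j, by omega⟩
            rw [hz, contour_pt_detour hzτ, hN, sub_self, seg_zero, List.append_nil,
              show lo i0 + (j : ℤ) - hi i0 = -(i : ℤ) by push_cast at hN; omega, hu, hol_append, hol_seg_backtrack,
              ← hol_append]
    · -- `u` is a prefix of the high part: `z = (y₁, y₂, …)`-type point, usual, exact word
      obtain ⟨h1, -, h3⟩ := tw_prefix highDirs_nodup (fun κ _ => hv κ) hc'
      have h0 : disp u i0 = 0 := h3 i0 i0_not_mem_highDirs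
      have h1' : disp u i1 = 0 := h3 i1 i1_not_mem_highDirs
      have hz : (lo + disp u) i0 ≤ τ := by rw [Pi.add_apply, h0, add_zero]; exact hlo
      rw [contour_of_le hz, add_sub_cancel_left, treeWord_eq, h1, h1', h0, seg_zero, seg_zero, List.append_nil,
        List.append_nil]

/-- **Gauge fixing along the tree, bondwise.** If `U` agrees with `V` on the bonds of `Γ_{y,x}` (`x ∈ P₁`), then the
field `U^v` with `v(z) = V(Γ_{y,z})` has ALL its bond variables along `Γ_{y,x}` equal to `1` — the printed gauge
condition of [IV] p. 196 for the gauge transformation of [Balaban1989LargeFieldII] p. 381. [cite: Balaban1989LargeFieldI, p.196] -/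
theorem bondsOneAlong_gaugeAct_of_agree (V U : Site (n + 3) → Fin (n + 3) → G) (hlo : lo i0 ≤ τ)
    (hτ : τ < hi i0) {x : Site (n + 3)} (hx : x ∈ box lo hi)
    (hUV : ∀ (w₁ w₂ : List (Letter (n + 3))) (l : Letter (n + 3)), contour lo hi τ x = w₁ ++ l :: w₂ →
      stepHol U (lo + disp w₁) l = stepHol V (lo + disp w₁) l) :
    BondsOneAlong (gaugeAct (treeGaugeFn V lo hi τ) U) lo (contour lo hi τ x) := by
  intro w₁ w₂ l hw
  have h1 := hol_contour_prefix V hlo hτ hx hw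
  have h2 : hol V lo (contour lo hi τ (lo + disp w₁ + l.vec)) = hol V lo w₁ * stepHol V (lo + disp w₁) l := by
    have := hol_contour_prefix V hlo hτ hx (u := w₁ ++ [l]) (u' := w₂) (by rw [hw]; simp)
    rwa [disp_append, disp_cons, disp_nil, add_zero, ← add_assoc, hol_append, hol_cons, hol_nil, mul_one] at this
  rw [stepHol_gaugeAct, hUV w₁ w₂ l hw, treeGaugeFn, treeGaugeFn, h1, h2, mul_inv_cancel]

/-- **[IV] p. 196 / [V] p. 381, bondwise: `v(x) = V(Γ_{y,x})` puts `V` in the tree gauge** — for `y₁ ≦ a < b₁ − 1/2`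
and `x ∈ P₁`, every bond variable of `V^v` along `Γ_{y,x}` equals `1` (*"putting the bond variables equal to 1 for
bonds belonging to the tree graph"*; PART 2's `hol_treeGauge_contour` is the contour form `V^v(Γ_{y,x}) = 1`).
[cite: Balaban1989LargeFieldI, p.196] -/
theorem bondsOneAlong_gaugeFixed (V : Site (n + 3) → Fin (n + 3) → G) (hlo : lo i0 ≤ τ) (hτ : τ < hi i0)
    {x : Site (n + 3)} (hx : x ∈ box lo hi) :
    BondsOneAlong (gaugeAct (treeGaugeFn V lo hi τ) V) lo (contour lo hi τ x) :=
  bondsOneAlong_gaugeAct_of_agree V V hlo hτ hx fun _ _ _ _ => rfl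

variable {lo' hi' : Site (n + 3)}

/-- The same on the annulus `P₁ ∖ P₂` under the geometric hypotheses `Geom` of PART 2 (`a ∈ (a′₁, b′₁)`, `P₂`
strictly inside `P₁`): every gauge orbit meets the tree-gauge slice on `T = ⋃_{x ∈ P₁∖P₂} Γ_{y,x}`.
[cite: Balaban1989LargeFieldI, p.196] -/
theorem bondsOneAlong_gaugeFixed_ann (V : Site (n + 3) → Fin (n + 3) → G) (hG : Geom lo hi lo' hi' τ)
    {x : Site (n + 3)} (hx : x ∈ ann lo hi lo' hi') :
    BondsOneAlong (gaugeAct (treeGaugeFn V lo hi τ) V) lo (contour lo hi τ x) :=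
  bondsOneAlong_gaugeFixed V hG.lo_le_tau (lt_of_le_of_lt hG.tau_le (hG.lt_hi i0)) hx.1

end ContourPrefix

/-! ## §12 p. 381: the printed `V₁ = (V′V₀)^v`, `v(x) = V₀(Γ_{y,x})`, satisfies the axial gauge conditions bondwise -/

section FluctSlice

variable {n : ℕ} {𝔸 : Type*} [NormedRing 𝔸] [NormOneClass 𝔸]
variable {lo hi lo' hi' : Site (n + 3)} {τ : ℤ} {W : ℕ} {V' V₀ : Site (n + 3) → Fin (n + 3) → 𝔸ˣ} {ε η : ℝ}

/-- **p. 381: "We obtain the field V₁ = V″^v = v₋V′V₀v₊⁻¹, which satisfies … the axial gauge conditions"** — in the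
situation `FluctHyp` (`V′ = 1` on the tree bonds, `v(x) = V₀(Γ_{y,x})`), every bond variable of `V₁ = (V′V₀)^v` along
every contour `Γ_{y,x}`, `x ∈ P₁∖P₂`, equals `1` (bondwise form of [IV] p. 196; PART 3's `FluctHyp.case1Hyp` had the
contour form). [cite: Balaban1989LargeFieldII, p.381] -/
theorem FluctHyp.bondsOneAlong_V₁ (H : FluctHyp lo hi lo' hi' τ W V' V₀ ε η) {x : Site (n + 3)}
    (hx : x ∈ ann lo hi lo' hi') :
    BondsOneAlong (gaugeAct (treeGaugeFn V₀ lo hi τ) (mulCfg V' V₀)) lo (contour lo hi τ x) :=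
  bondsOneAlong_gaugeAct_of_agree V₀ (mulCfg V' V₀) H.geom.lo_le_tau
    (lt_of_le_of_lt H.geom.tau_le (H.geom.lt_hi i0)) hx.1
    fun w₁ w₂ l hw => stepHol_mulCfg_of_eq_one (H.tree x hx w₁ w₂ l hw)

end FluctSlice

end Literature.MathematicalPhysics.QuantumFieldTheory.Balaban1983to89.B16Ineq382
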